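import Summits.Ventures.PercRepro.S1CoreCapClasses
import Summits.Ventures.PercRepro.S1CoreCapSpec
import Summits.Ventures.PercRepro.RankLevelSetPlaneTen
import Summits.Ventures.PercRepro.RankLevelSetCircuitCount

/-!
# PercRepro — the cost and plane clauses of the 4-circuit-cap spec hold on the core (p1, gen 22; the s₄ seat)

`proofs/P1-S4-CAPBRIDGE.md` §4. For any list `l` of lines of the configuration of `e` (`S1CoreCapClasses.config`),
the points of its classes together with `e` span rank at most `lineRank l + 1` in `M`
(`eRk_insert_pts_unionL_le`): adding a line raises the rank by at most the number of its new classes (each class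
lies in the closure of `e` and a representative) and by at most `2 − min(old, 2)` (submodularity against the
plane, which meets the earlier points in `e` plus `old` classes of rank `1 + min(old, 2)`). Hence the COST CLAUSE
`wsum (unionL l) ≤ ν + lineRank l` (the nullity bound `|X| ≤ r(X) + ν`) and the PLANE CLAUSES (`lineRank l ≤ 3`
⟹ `≤ 9` classes, by p2's solids `≤ 10`; `lineRank l ≤ 4` ⟹ `≤ 20` classes, by night-1's cover recursion).
Axioms: standard.
-/

open scoped Matroid

namespace PercRepro

namespace S1

open Set

variable {α : Type}

open FourCap

/-- Adding the points of a finite set of classes to a set containing `e` raises the rank by at most the number of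
classes (each class lies in the closure of `e` and its representative). -/
theorem eRk_union_pts_le (M : Matroid α) [M.Finite] {e : α} (he : e ∈ M.E) {X : Set α} (hX : X ⊆ M.E)
    (heX : e ∈ X) (S : Finset (Set α)) (hS : ∀ v ∈ S, ∃ q ∈ M.E, q ≠ e ∧ v = cls M e q) :
    M.eRk (X ∪ pts S) ≤ M.eRk X + S.card := by
  classical
  induction S using Finset.induction_on with
  | empty => simp [pts_empty]
  | insert v S hvS ih =>
    rw [pts_insert, Finset.card_insert_of_notMem hvS]
    obtain ⟨q, hqE, _, rfl⟩ := hS v (Finset.mem_insert_self v S)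
    have ih' := ih (fun u hu => hS u (Finset.mem_insert_of_mem hu))
    have h1 : X ∪ (cls M e q ∪ pts S) = (X ∪ pts S) ∪ cls M e q := by
      rw [union_comm (cls M e q), union_assoc]
    rw [h1]
    have hptsE : pts S ⊆ M.E := by
      intro t ht
      obtain ⟨u, hu, htu⟩ := mem_pts.1 ht
      obtain ⟨r, _, _, rfl⟩ := hS u (Finset.mem_insert_of_mem hu)
      exact mem_ground_of_mem_cls M htu
    have hsub : (X ∪ pts S) ∪ cls M e q ⊆ M.closure (insert q (X ∪ pts S)) := by
      intro t ht
      rcases ht with ht | ht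
      · exact M.mem_closure_of_mem' (mem_insert_of_mem q ht) (union_subset hX hptsE ht)
      · exact cls_subset_closure M (M.mem_closure_of_mem' (mem_insert_of_mem q (Or.inl heX)) he)
          (M.mem_closure_of_mem' (mem_insert q _) hqE) ht
    calc M.eRk ((X ∪ pts S) ∪ cls M e q) ≤ M.eRk (M.closure (insert q (X ∪ pts S))) := M.eRk_mono hsub
      _ = M.eRk (insert q (X ∪ pts S)) := M.eRk_closure_eq _
      _ ≤ M.eRk (X ∪ pts S) + 1 := M.eRk_insert_le_add_one _ _
      _ ≤ M.eRk X + S.card + 1 := add_le_add ih' (le_refl 1)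
      _ = M.eRk X + ((S.card + 1 : ℕ) : ℕ∞) := by push_cast; ring

/-- ℕ∞ bookkeeping for the submodular step: from `r(U ∩ P) + r(U ∪ P) ≤ r U + 3` and `m + 1 ≤ r(U ∩ P)` with
`m ≤ 2`, `r(U ∪ P) ≤ r U + (2 − m)`. -/
theorem eRk_union_le_of_submod (M : Matroid α) [M.Finite] {U P : Set α} (hU : U ⊆ M.E) (hP : P ⊆ M.E)
    (hsub : M.eRk (U ∩ P) + M.eRk (U ∪ P) ≤ M.eRk U + 3) {m : ℕ} (hm2 : m ≤ 2)
    (hm : ((m : ℕ) : ℕ∞) + 1 ≤ M.eRk (U ∩ P)) : M.eRk (U ∪ P) ≤ M.eRk U + ((2 - m : ℕ) : ℕ∞) := by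
  have hUne : M.eRk U ≠ ⊤ :=
    ne_top_of_le_ne_top (M.ground_finite.subset hU).encard_lt_top.ne (M.eRk_le_encard U)
  have hUPne : M.eRk (U ∪ P) ≠ ⊤ :=
    ne_top_of_le_ne_top (M.ground_finite.subset (union_subset hU hP)).encard_lt_top.ne (M.eRk_le_encard _)
  have hIne : M.eRk (U ∩ P) ≠ ⊤ := ne_top_of_le_ne_top hUne (M.eRk_mono inter_subset_left)
  obtain ⟨u, hu⟩ := ENat.ne_top_iff_exists.1 hUne
  obtain ⟨a, ha⟩ := ENat.ne_top_iff_exists.1 hUPne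
  obtain ⟨i, hi⟩ := ENat.ne_top_iff_exists.1 hIne
  rw [← hu, ← ha, ← hi] at hsub
  rw [← hi] at hm
  rw [← hu, ← ha]
  have h1 : i + a ≤ u + 3 := by exact_mod_cast hsub
  have h2 : m + 1 ≤ i := by exact_mod_cast hm
  have h3 : a ≤ u + (2 - m) := by omega
  exact_mod_cast h3

open Classical in
/-- **The rank bound of the cost model, in classes**: for any list of lines of the configuration of `e`, the points
of their classes together with `e` span rank at most `lineRank l + 1` in `M`. -/
theorem eRk_insert_pts_unionL_le (M : Matroid α) [M.Finite]
    (hfree : ∀ e ∈ M.E, ∃ A ⊆ M.E \ {e}, e ∉ M.closure A ∧ e ∉ M.closure ((M.E \ {e}) \ A))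
    {e : α} (he : e ∈ M.E) :
    ∀ l : List (Finset (Set α)), (∀ L ∈ l, L ∈ config M e) →
      M.eRk (insert e (pts (unionL l))) ≤ (lineRank l : ℕ∞) + 1
  | [], _ => by
    simp only [unionL, pts_empty, insert_empty_eq, lineRank, Nat.cast_zero, zero_add]
    exact (M.eRk_le_encard _).trans (by rw [encard_singleton])
  | L :: l, h => by
    have ih := eRk_insert_pts_unionL_le M hfree he l (fun L' hL' => h L' (List.mem_cons_of_mem L hL'))
    have hL := h L List.mem_cons_self
    obtain ⟨C, ⟨hC, h4, heC⟩, rfl⟩ := mem_config.1 hL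
    have hCE : C ⊆ M.E := hC.subset_ground
    set U := insert e (pts (unionL l)) with hU
    set P := M.closure C with hP
    have hPE : P ⊆ M.E := M.closure_subset_ground C
    have heP : e ∈ P := M.mem_closure_of_mem' heC (hCE heC)
    have hptsE : pts (unionL l) ⊆ M.E := by
      intro t ht
      obtain ⟨u, hu, htu⟩ := mem_pts.1 ht
      have : ∃ L' ∈ l, u ∈ L' := mem_unionL_iff.1 hu
      obtain ⟨L', hL', huL'⟩ := this
      obtain ⟨r, _, _, rfl⟩ := exists_rep_of_mem_config (h L' (List.mem_cons_of_mem _ hL')) huL'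
      exact mem_ground_of_mem_cls M htu
    have hUE : U ⊆ M.E := insert_subset he hptsE
    have hptsL : pts (lineOf M e C) = P \ {e} := pts_lineOf M hCE heC
    have hgoal : insert e (pts (unionL (lineOf M e C :: l))) = U ∪ P := by
      simp only [unionL]
      rw [pts_union, hptsL]
      ext t
      simp only [hU, mem_insert_iff, mem_union, mem_sdiff, mem_singleton_iff]
      by_cases hte : t = e
      · subst hte; simp [heP]
      · simp [hte]; tauto
    -- Bound A: the new classes
    have hA : M.eRk (U ∪ P) ≤ M.eRk U + ((lineOf M e C \ unionL l).card : ℕ∞) := by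
      have h1 : U ∪ P = U ∪ pts (lineOf M e C \ unionL l) := by
        ext t; constructor
        · rintro (ht | ht)
          · exact Or.inl ht
          · by_cases hte : t = e
            · exact Or.inl (hte ▸ mem_insert e _)
            · have ht' : t ∈ pts (lineOf M e C) := hptsL ▸ ⟨ht, hte⟩
              obtain ⟨v, hv, htv⟩ := mem_pts.1 ht'
              by_cases hvl : v ∈ unionL l
              · exact Or.inl (mem_insert_of_mem e (mem_pts.2 ⟨v, hvl, htv⟩))
              · exact Or.inr (mem_pts.2 ⟨v, Finset.mem_sdiff.2 ⟨hv, hvl⟩, htv⟩)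
        · rintro (ht | ht)
          · exact Or.inl ht
          · have := pts_mono Finset.sdiff_subset ht
            rw [hptsL] at this
            exact Or.inr this.1
      rw [h1]
      exact eRk_union_pts_le M he hUE (mem_insert e _) _
        (fun v hv => exists_rep_of_mem_lineOf (Finset.mem_sdiff.1 hv).1)
    -- Bound B: submodularity against the plane `P`
    have hB : M.eRk (U ∪ P) ≤ M.eRk U + ((2 - min (lineOf M e C ∩ unionL l).card 2 : ℕ) : ℕ∞) := by
      have hsub : M.eRk (U ∩ P) + M.eRk (U ∪ P) ≤ M.eRk U + 3 := by
        have := M.eRk_inter_add_eRk_union_le U P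
        rwa [hP, eRk_closure_fourCircuit M hC h4] at this
      refine eRk_union_le_of_submod M hUE hPE hsub (min_le_right _ _) ?_
      set old := lineOf M e C ∩ unionL l with hold
      have hmemU : ∀ v ∈ old, ∀ q ∈ M.E, q ≠ e → v = cls M e q → q ∈ U ∩ P := by
        intro v hv q hqE hqe hvq
        have hq : q ∈ v := hvq ▸ mem_cls_self M hqE hqe.symm
        refine ⟨mem_insert_of_mem e (mem_pts.2 ⟨v, (Finset.mem_inter.1 hv).2, hq⟩), ?_⟩
        have : q ∈ pts (lineOf M e C) := mem_pts.2 ⟨v, (Finset.mem_inter.1 hv).1, hq⟩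
        rw [hptsL] at this
        exact this.1
      rcases Nat.lt_or_ge old.card 2 with hlt | hge
      · rcases Nat.lt_or_ge old.card 1 with h0 | h1
        · have hm : min old.card 2 = 0 := by omega
          rw [hm, Nat.cast_zero, zero_add]
          have hnl : M.IsNonloop e := Matroid.isNonloop_of_not_isLoop he (ThmN.not_isLoop_of_free M hfree e he)
          rw [← hnl.eRk_eq]
          exact M.eRk_mono (singleton_subset_iff.2 ⟨mem_insert e _, heP⟩)
        · have hm : min old.card 2 = 1 := by omega
          rw [hm]
          obtain ⟨v, hv⟩ := Finset.card_pos.1 h1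
          obtain ⟨q, hqE, hqe, rfl⟩ := exists_rep_of_mem_lineOf (Finset.mem_inter.1 hv).1
          have hq := hmemU _ hv q hqE hqe rfl
          have hle : M.eRk {e, q} ≤ M.eRk (U ∩ P) := by
            refine M.eRk_mono ?_
            intro t ht; simp only [mem_insert_iff, mem_singleton_iff] at ht
            rcases ht with rfl | rfl
            · exact ⟨mem_insert t _, heP⟩
            · exact hq
          rw [eRk_pair_eq_two M hfree he hqE hqe.symm] at hle
          exact le_of_eq_of_le (by norm_num) hle
      · have hm : min old.card 2 = 2 := by omega
        rw [hm]
        obtain ⟨v₁, hv₁, v₂, hv₂, hne⟩ := Finset.one_lt_card.1 hge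
        obtain ⟨q₁, hq₁E, hq₁e, rfl⟩ := exists_rep_of_mem_lineOf (Finset.mem_inter.1 hv₁).1
        obtain ⟨q₂, hq₂E, hq₂e, rfl⟩ := exists_rep_of_mem_lineOf (Finset.mem_inter.1 hv₂).1
        have hq₁ := hmemU _ hv₁ q₁ hq₁E hq₁e rfl
        have hq₂ := hmemU _ hv₂ q₂ hq₂E hq₂e rfl
        have hle : M.eRk {e, q₁, q₂} ≤ M.eRk (U ∩ P) := by
          refine M.eRk_mono ?_
          intro t ht; simp only [mem_insert_iff, mem_singleton_iff] at ht
          rcases ht with rfl | rfl | rfl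
          · exact ⟨mem_insert t _, heP⟩
          · exact hq₁
          · exact hq₂
        rw [eRk_triple_eq_three_of_cls_ne M hfree he hq₁E hq₂E hq₁e.symm hq₂e.symm hne] at hle
        exact le_of_eq_of_le (by norm_num) hle
    have hmin : M.eRk (U ∪ P) ≤ M.eRk U +
        ((min (lineOf M e C \ unionL l).card (2 - min (lineOf M e C ∩ unionL l).card 2) : ℕ) : ℕ∞) := by
      rcases Nat.le_total (lineOf M e C \ unionL l).card (2 - min (lineOf M e C ∩ unionL l).card 2) with hle | hle
      · rw [Nat.min_eq_left hle]; exact hA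
      · rw [Nat.min_eq_right hle]; exact hB
    rw [hgoal]
    calc M.eRk (U ∪ P) ≤ M.eRk U + _ := hmin
      _ ≤ ((lineRank l : ℕ∞) + 1) + _ := add_le_add ih (le_refl _)
      _ = (lineRank (lineOf M e C :: l) : ℕ∞) + 1 := by simp only [lineRank]; push_cast; ring


/-! ### The cost and plane clauses -/

/-- The nullity bound: a subset of the ground set of a matroid of nullity `d` has at most `rank + d` points. -/
theorem ncard_le_of_eRk_le_add_nullity (M : Matroid α) [M.Finite] {d : ℕ} (hd : M.E.encard = M.eRank + d)
    {X : Set α} (hX : X ⊆ M.E) {r : ℕ} (hr : M.eRk X ≤ r) : X.ncard ≤ r + d := by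
  have hEX : M.E.ncard = X.ncard + (M.E \ X).ncard := by
    have := ncard_sdiff_add_ncard_of_subset hX M.ground_finite
    omega
  have hrE : M.eRank ≤ M.eRk X + ((M.E \ X).ncard : ℕ∞) := by
    rw [_root_.Matroid.eRank_def]
    have h1 : M.E = X ∪ (M.E \ X) := (union_sdiff_cancel hX).symm
    conv_lhs => rw [h1]
    refine (M.eRk_union_le_eRk_add_eRk _ _).trans (add_le_add (le_refl _) ?_)
    refine (M.eRk_le_encard _).trans (le_of_eq ?_)
    rw [Set.Finite.cast_ncard_eq (M.ground_finite.subset sdiff_subset)]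
  obtain ⟨R, hR⟩ := ENat.ne_top_iff_exists.1 (PercRepro.Matroid.eRank_ne_top_of_finite M)
  have hn : M.E.ncard = R + d := by
    have := hd
    rw [← hR, ← Set.Finite.cast_ncard_eq M.ground_finite] at this
    exact_mod_cast this
  have hrX : M.eRk X ≠ ⊤ := ne_top_of_le_ne_top (ENat.coe_ne_top r) hr
  obtain ⟨rX, hrX'⟩ := ENat.ne_top_iff_exists.1 hrX
  have h1 : R ≤ rX + (M.E \ X).ncard := by
    have := hrE
    rw [← hR, ← hrX'] at this
    exact_mod_cast this
  have h2 : rX ≤ r := by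
    have := hr
    rw [← hrX'] at this
    exact_mod_cast this
  omega

/-- `e` lies on no class (classes are M-lines through `e` minus `e`): `e ∉ pts L` for a set of classes. -/
theorem notMem_pts_of_classes {M : Matroid α} {e : α} {L : Finset (Set α)}
    (hL : ∀ v ∈ L, ∃ q ∈ M.E, q ≠ e ∧ v = cls M e q) : e ∉ pts L := by
  intro h
  obtain ⟨v, hv, hev⟩ := mem_pts.1 h
  obtain ⟨q, _, _, rfl⟩ := hL v hv
  exact ne_of_mem_cls M hev rfl

open Classical in
/-- Every member of the union of a list of lines of the configuration is a class. -/
theorem exists_rep_of_mem_unionL {M : Matroid α} [M.Finite] {e : α} {l : List (Finset (Set α))}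
    (hl : ∀ L ∈ l, L ∈ config M e) {v : Set α} (hv : v ∈ unionL l) : ∃ q ∈ M.E, q ≠ e ∧ v = cls M e q := by
  obtain ⟨L, hL, hvL⟩ := mem_unionL_iff.1 hv
  exact exists_rep_of_mem_config (hl L hL) hvL

open Classical in
/-- **The cost clause** for the configuration of `e`: `wsum (unionL l) ≤ ν + lineRank l`. -/
theorem wsum_unionL_le (M : Matroid α) [M.Finite]
    (hfree : ∀ e ∈ M.E, ∃ A ⊆ M.E \ {e}, e ∉ M.closure A ∧ e ∉ M.closure ((M.E \ {e}) \ A))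
    {d : ℕ} (hd : M.E.encard = M.eRank + d) {e : α} (he : e ∈ M.E) (l : List (Finset (Set α)))
    (hl : ∀ L ∈ l, L ∈ config M e) : wsum Set.ncard (unionL l) ≤ d + lineRank l := by
  have hcls : ∀ v ∈ unionL l, ∃ q ∈ M.E, q ≠ e ∧ v = cls M e q := fun v hv => exists_rep_of_mem_unionL hl hv
  have hptsE : pts (unionL l) ⊆ M.E := by
    intro t ht
    obtain ⟨v, hv, htv⟩ := mem_pts.1 ht
    obtain ⟨q, _, _, rfl⟩ := hcls v hv
    exact mem_ground_of_mem_cls M htv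
  have hX : insert e (pts (unionL l)) ⊆ M.E := insert_subset he hptsE
  have hr := eRk_insert_pts_unionL_le M hfree he l hl
  have h1 := ncard_le_of_eRk_le_add_nullity M hd hX (r := lineRank l + 1) (by exact_mod_cast hr)
  rw [ncard_insert_of_notMem (notMem_pts_of_classes hcls) (M.ground_finite.subset hptsE),
    ncard_pts_eq_sum M hfree he _ hcls] at h1
  unfold wsum
  omega

open Classical in
/-- **The plane clauses** for the configuration of `e`: a sub-family of rank bound `≤ 3` covers `≤ 9` classes,
one of rank bound `≤ 4` covers `≤ 20`. -/
theorem card_unionL_le_of_lineRank_le (M : Matroid α) [M.Finite]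
    (hfree : ∀ e ∈ M.E, ∃ A ⊆ M.E \ {e}, e ∉ M.closure A ∧ e ∉ M.closure ((M.E \ {e}) \ A))
    {e : α} (he : e ∈ M.E) (l : List (Finset (Set α))) (hl : ∀ L ∈ l, L ∈ config M e) :
    (lineRank l ≤ 3 → (unionL l).card ≤ 9) ∧ (lineRank l ≤ 4 → (unionL l).card ≤ 20) := by
  have hcls : ∀ v ∈ unionL l, ∃ q ∈ M.E, q ≠ e ∧ v = cls M e q := fun v hv => exists_rep_of_mem_unionL hl hv
  have hptsE : pts (unionL l) ⊆ M.E := by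
    intro t ht
    obtain ⟨v, hv, htv⟩ := mem_pts.1 ht
    obtain ⟨q, _, _, rfl⟩ := hcls v hv
    exact mem_ground_of_mem_cls M htv
  have hX : insert e (pts (unionL l)) ⊆ M.E := insert_subset he hptsE
  have hr := eRk_insert_pts_unionL_le M hfree he l hl
  have hcard := card_le_ncard_pts M hfree he _ hcls
  have hins := ncard_insert_of_notMem (notMem_pts_of_classes hcls) (M.ground_finite.subset hptsE)
  have hten : ∀ Y ⊆ M.E, M.eRk Y ≤ 4 → Y.ncard ≤ 10 := fun Y hY hY4 =>
    ThmN.ncard_le_ten_of_eRk_le_four_of_free M hfree hY hY4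
  constructor
  · intro h3
    have hr4 : M.eRk (insert e (pts (unionL l))) ≤ 4 := by
      refine hr.trans ?_
      have : (lineRank l : ℕ∞) + 1 ≤ ((lineRank l + 1 : ℕ) : ℕ∞) := by push_cast; exact le_refl _
      refine this.trans ?_
      exact_mod_cast (by omega : lineRank l + 1 ≤ 4)
    have := hten _ hX hr4
    omega
  · intro h4
    have hr5 : M.eRk (insert e (pts (unionL l))) ≤ 4 + 1 := by
      refine hr.trans ?_
      have : (lineRank l : ℕ∞) + 1 ≤ ((lineRank l + 1 : ℕ) : ℕ∞) := by push_cast; exact le_refl _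
      refine this.trans ?_
      exact_mod_cast (by omega : lineRank l + 1 ≤ 4 + 1)
    have := ThmN.ncard_le_two_mul_add_one_of_free M hfree hten _ hX hr5
    omega


end S1

end PercRepro
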